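import Literature.NumberTheory.Transcendental.ManyCurvePeriodsIsotypic
import Literature.NumberTheory.EllipticCurves.LatticeInclusionRigidityProofs
import Literature.NumberTheory.EllipticCurves.UniformizationUniqueProofs
import Literature.NumberTheory.EllipticCurves.RealLatticePeriod
import Mathlib.RingTheory.Algebraic.Integral
import Mathlib.Algebra.Algebra.Hom.Rat

/-!
# `XMapKernel`, line `isogeny-orbit-collapse` — stub **T**: the Huber–Wüstholz splitting

Support file for the crux `IsogenyCertificates.XMapKernel` (stmt-KontsevichZagierPeriods-10663), line
`isogeny-orbit-collapse`, stub `stub_huberWustholzSplitting` — the line's only transcendence input.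

**Statement (T).** For lattices `Λ₁, …, Λ_k ⊂ ℂ` (Mathlib `PeriodPair`) with algebraic invariants
`g₂, g₃` and algebraic `βⱼ, β'ⱼ`, a vanishing combination `∑ⱼ (βⱼ ω₁⁽ʲ⁾ + β'ⱼ ω₂⁽ʲ⁾) = 0` of the
fundamental periods SPLITS ALONG THE ISOGENY CLASSES: for every `i` and its class
`S = {j | Λᵢ ~ Λⱼ}` (`PeriodPair.IsIsogenousTo`: some `α ≠ 0` with `αΛᵢ ⊆ Λⱼ`; an equivalence
relation by the tree's `isIsogenousTo_refl`, `.symm`, `.trans`), `∑_{j ∈ S} (βⱼ ω₁⁽ʲ⁾ + β'ⱼ ω₂⁽ʲ⁾) = 0`.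

**Status: closed modulo ONE cited fact of the tree**, the pairwise NON-isogenous `k`-curve instance
of the Huber–Wüstholz dimension formula, `Literature.NumberTheory.Transcendental.HuberWustholzManyCurvePeriods`
(`…/Transcendental/ManyCurvePeriods.lean`; Huber–Wüstholz, Cambridge Tract 227 (2022), Thm. 15.3
(1), (3) for `[ℤ →⁰ 𝔾ₘ] × E₁ × ⋯ × E_k`, `Eᵢ` pairwise non-isogenous; historically Wüstholz's
solution of Baker's period problem, Baker–Wüstholz 2007, §6.2, Thm. 6.4, "group together the
pairwise isogenous factors"). The fact is UNPROVED in the tree (the analytic subgroup theorem); its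
one-curve case is proved there (`masser_ellipticPeriods_holds`). T allows isogenies among the `Λⱼ`;
the tree's stronger fact for that case, `HuberWustholzIsotypicSplitting`, gives T in one line
(`HuberWustholzIsotypicSplitting.omega_subsum`, in the tree), and its module docstring names the
input "the tree lacks" for a derivation from the pairwise non-isogenous fact: *the multiplier `α`
of an analytic isogeny `αΛ ⊆ Λ'` between lattices with algebraic invariants is algebraic*. THIS
FILE PROVES THAT INPUT (§1) and then T from `HuberWustholzManyCurvePeriods` alone (§2), so the
stub is blocked on the weaker of the two facts.

**§1 — the multiplier is algebraic** (`isAlgebraic_of_mul_mem_lattice`), via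
`isAlgebraic_g₂_g₃_of_le`: *an over-lattice `M ⊇ Λ` of a lattice with algebraic invariants has
algebraic invariants*, by `Aut(ℂ)`-rigidity with the tree's tools: `Λ ⊆ M ⊆ N⁻¹Λ` for an integer
`N ≥ 1` (`exists_nat_mul_mem_of_le`); for `σ ∈ Aut(ℂ)` the lattices `Λ^σ ⊆ M^σ ⊆ N⁻¹Λ^σ` with
invariants `σ(g₂, g₃)` exist (`PeriodPair.uniformization_holds`, `PeriodPair.lattice_le_of_le_map`);
`Λ^σ` is one of finitely many lattices (conjugate invariants, `uniformization_unique_holds`) and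
`M^σ = Λ^σ + ℤf₁ + ℤf₂` with `f₁, f₂` among `N²` points (`lattice_eq_sup_span`); so `σ(gᵢ(M))`
ranges over a finite set, and a complex number with finite `Aut(ℂ)`-orbit is algebraic
(`Complex.isIntegral_of_forall_ringEquiv_mem`, Cox §10.C). For `αΛ ⊆ Λ'` take `M = α⁻¹Λ'`,
whose invariants are `α⁴g₂(Λ')`, `α⁶g₃(Λ')`.

**§2 — T from the fact.** With `r(j)` the least index in the class of `j` and `αⱼΛⱼ ⊆ Λ_{r(j)}`,
`βⱼω₁⁽ʲ⁾ + β'ⱼω₂⁽ʲ⁾ = uⱼω₁^{(r(j))} + vⱼω₂^{(r(j))}` with `uⱼ, vⱼ ∈ ℚ̄` (§1); summing over the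
fibres of `r` gives `∑_r (A_r ω₁⁽ʳ⁾ + B_r ω₂⁽ʳ⁾) = 0` over the pairwise non-isogenous
representatives with algebraic `A_r, B_r`; the fact (zero coefficients on `1, 2πi, η₁, η₂`) kills
every block, and the block of `r(i)` is the class sub-sum of `i`.

**Sanity of T as stated.** `k = 0` is vacuous; `i ∈ S` always (reflexivity), so T is not vacuous;
repeated lattices and CM relations `ω₂ = τω₁` live inside one class; the asymmetric shape of
`IsIsogenousTo` is harmless (`symm`/`trans`); T is a theorem (Wüstholz 1984/1989), so no side
condition is missing. No definitions and no new named facts are introduced.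

References: [HuberWustholz2022] Thm. 15.3 (1), (3) p. 145; §15.2.2 pp. 149–150; p. 193.
[BakerWustholz2007] §6.2 pp. 95–99, Thm. 6.4. [Cox2013] §10.C. [SilvermanAEC2009] Thm. VI.4.1,
VI.5.1. G. Wüstholz, Ann. of Math. 129 (1989) 501–517.
-/

noncomputable section

namespace Summit.KontsevichZagierPeriods.IsogenyCertificates.XMapKernelStubs.HuberWustholzSplitting

open scoped BigOperators
open Complex Polynomial Literature.FieldTheory.AlgClosed Literature.NumberTheory.Transcendental

/-! ## §1 The multiplier of an isogeny between lattices with algebraic invariants is algebraic -/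

/-- **A sub-lattice has finite index**: if `Λ ⊆ M` for period pairs `L, M`, then `N·M ⊆ Λ` for
some integer `N ≥ 1` (write `ω₁ = aω₁' + bω₂'`, `ω₂ = cω₁' + dω₂'`; `D = ad − bc ≠ 0` by the
`ℝ`-independence of `ω₁, ω₂`, `Dω₁' = dω₁ − bω₂`, `Dω₂' = −cω₁ + aω₂`, and `N = D²`). [folklore] -/
theorem exists_nat_mul_mem_of_le {L M : PeriodPair} (h : L.lattice ≤ M.lattice) :
    ∃ N : ℕ, N ≠ 0 ∧ ∀ x ∈ M.lattice, (N : ℂ) * x ∈ L.lattice := by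
  obtain ⟨a, b, hab⟩ := PeriodPair.mem_lattice.1 (h L.ω₁_mem_lattice)
  obtain ⟨c, d, hcd⟩ := PeriodPair.mem_lattice.1 (h L.ω₂_mem_lattice)
  have hind : ∀ s t : ℤ, (s : ℂ) * L.ω₁ + (t : ℂ) * L.ω₂ = 0 → s = 0 ∧ t = 0 := by
    intro s t hst
    have := LinearIndependent.pair_iff.mp L.indep (s : ℝ) (t : ℝ) (by simpa using hst)
    exact_mod_cast this
  set D : ℤ := a * d - b * c with hD_def
  have hD1 : (D : ℂ) * M.ω₁ = (d : ℂ) * L.ω₁ - (b : ℂ) * L.ω₂ := by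
    rw [hD_def]; push_cast; linear_combination (d : ℂ) * hab - (b : ℂ) * hcd
  have hD2 : (D : ℂ) * M.ω₂ = -(c : ℂ) * L.ω₁ + (a : ℂ) * L.ω₂ := by
    rw [hD_def]; push_cast; linear_combination (-(c : ℂ)) * hab + (a : ℂ) * hcd
  have hD : D ≠ 0 := by
    intro hD0
    rw [hD0] at hD1 hD2
    simp only [Int.cast_zero, zero_mul] at hD1 hD2
    obtain ⟨-, hb0⟩ := hind d (-b) (by push_cast; linear_combination -hD1)
    obtain ⟨-, ha0⟩ := hind (-c) a (by push_cast; linear_combination -hD2)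
    have hb : b = 0 := by omega
    have hω : L.ω₁ ≠ 0 := by simpa using L.indep.ne_zero 0
    exact hω (by rw [← hab, ha0, hb]; simp)
  have hmem : ∀ x ∈ M.lattice, (D : ℂ) * x ∈ L.lattice := by
    intro x hx
    obtain ⟨m, n, rfl⟩ := PeriodPair.mem_lattice.1 hx
    refine PeriodPair.mem_lattice.2 ⟨m * d - n * c, n * a - m * b, ?_⟩
    have key : (D : ℂ) * ((m : ℂ) * M.ω₁ + (n : ℂ) * M.ω₂)
        = (m : ℂ) * ((D : ℂ) * M.ω₁) + (n : ℂ) * ((D : ℂ) * M.ω₂) := by ring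
    rw [key, hD1, hD2]; push_cast; ring
  refine ⟨D.natAbs ^ 2, pow_ne_zero 2 (Int.natAbs_ne_zero.2 hD), fun x hx => ?_⟩
  have hcast : ((D.natAbs ^ 2 : ℕ) : ℂ) = (D : ℂ) * D := by
    rw [Nat.cast_pow, Nat.cast_natAbs, ← Int.cast_pow, sq_abs, Int.cast_pow, sq]
  rw [hcast, mul_assoc]
  exact hmem _ (h (hmem x hx))

/-- **Lattices between `Λ` and `N⁻¹Λ`.** If `Λ ⊆ M` and `N·M ⊆ Λ` (`N ≥ 1`) for period pairs
`M₁ = Λ`, `M₂ = M`, then `M = Λ + ℤf₁ + ℤf₂` with `f₁, f₂` among the `N²` points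
`(pω₁ + qω₂)/N`, `0 ≤ p, q < N` (reduce the coordinates of `Nω₁'`, `Nω₂'` modulo `N`). In
particular only finitely many lattices lie between `Λ` and `N⁻¹Λ`. [folklore] -/
theorem lattice_eq_sup_span {M₁ M₂ : PeriodPair} {N : ℕ} (hN : N ≠ 0)
    (hle : M₁.lattice ≤ M₂.lattice) (hN' : ∀ x ∈ M₂.lattice, (N : ℂ) * x ∈ M₁.lattice) :
    ∃ f ∈ ((Finset.range N ×ˢ Finset.range N).image fun pq : ℕ × ℕ =>
        ((pq.1 : ℂ) * M₁.ω₁ + (pq.2 : ℂ) * M₁.ω₂) / N) ×ˢ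
      ((Finset.range N ×ˢ Finset.range N).image fun pq : ℕ × ℕ =>
        ((pq.1 : ℂ) * M₁.ω₁ + (pq.2 : ℂ) * M₁.ω₂) / N),
      M₂.lattice = M₁.lattice ⊔ Submodule.span ℤ {f.1, f.2} := by
  have hNc : (N : ℂ) ≠ 0 := by exact_mod_cast hN
  have hNz : (N : ℤ) ≠ 0 := by exact_mod_cast hN
  have hNpos : (0 : ℤ) < N := by exact_mod_cast Nat.pos_of_ne_zero hN
  -- reduction of one point of `M` modulo `Λ` to one of the `N²` representatives
  have hred : ∀ x ∈ M₂.lattice, ∃ f ∈ ((Finset.range N ×ˢ Finset.range N).image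
      fun pq : ℕ × ℕ => ((pq.1 : ℂ) * M₁.ω₁ + (pq.2 : ℂ) * M₁.ω₂) / N), x - f ∈ M₁.lattice := by
    intro x hx
    obtain ⟨p, q, hpq⟩ := PeriodPair.mem_lattice.1 (hN' x hx)
    have hp0 : (0 : ℤ) ≤ p % N := Int.emod_nonneg p hNz
    have hq0 : (0 : ℤ) ≤ q % N := Int.emod_nonneg q hNz
    have hpN : p % N < N := Int.emod_lt_of_pos p hNpos
    have hqN : q % N < N := Int.emod_lt_of_pos q hNpos
    refine ⟨((((p % N).toNat : ℕ) : ℂ) * M₁.ω₁ + (((q % N).toNat : ℕ) : ℂ) * M₁.ω₂) / N, ?_, ?_⟩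
    · simp only [Finset.mem_image, Finset.mem_product, Finset.mem_range]
      exact ⟨((p % N).toNat, (q % N).toNat), ⟨by omega, by omega⟩, rfl⟩
    · have hp : (((p % N).toNat : ℕ) : ℂ) = ((p % N : ℤ) : ℂ) := by
        exact_mod_cast Int.toNat_of_nonneg hp0
      have hq : (((q % N).toNat : ℕ) : ℂ) = ((q % N : ℤ) : ℂ) := by
        exact_mod_cast Int.toNat_of_nonneg hq0
      refine PeriodPair.mem_lattice.2 ⟨p / N, q / N, ?_⟩
      have hp' : (p : ℂ) = (N : ℂ) * ((p / N : ℤ) : ℂ) + ((p % N : ℤ) : ℂ) := by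
        exact_mod_cast (Int.mul_ediv_add_emod p N).symm
      have hq' : (q : ℂ) = (N : ℂ) * ((q / N : ℤ) : ℂ) + ((q % N : ℤ) : ℂ) := by
        exact_mod_cast (Int.mul_ediv_add_emod q N).symm
      have hx' : x = ((p : ℂ) * M₁.ω₁ + (q : ℂ) * M₁.ω₂) / N := by
        rw [hpq]; field_simp
      rw [hp, hq, hx', hp', hq']; field_simp; ring
  obtain ⟨f₁, hf₁, hk₁⟩ := hred _ M₂.ω₁_mem_lattice
  obtain ⟨f₂, hf₂, hk₂⟩ := hred _ M₂.ω₂_mem_lattice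
  refine ⟨(f₁, f₂), Finset.mk_mem_product hf₁ hf₂, le_antisymm ?_ ?_⟩
  · show Submodule.span ℤ {M₂.ω₁, M₂.ω₂} ≤ _
    refine Submodule.span_le.2 ?_
    rintro x (rfl | rfl)
    · exact Submodule.mem_sup.2 ⟨_, hk₁, f₁, Submodule.subset_span (by simp), by ring⟩
    · exact Submodule.mem_sup.2 ⟨_, hk₂, f₂, Submodule.subset_span (by simp), by ring⟩
  · refine sup_le hle (Submodule.span_le.2 ?_)
    rintro x (rfl | rfl)
    · have := sub_mem M₂.ω₁_mem_lattice (hle hk₁)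
      rwa [sub_sub_cancel] at this
    · have := sub_mem M₂.ω₂_mem_lattice (hle hk₂)
      rwa [sub_sub_cancel] at this

/-- **An over-lattice of a lattice with algebraic invariants has algebraic invariants**: if
`Λ ⊆ M` and `g₂(Λ), g₃(Λ) ∈ ℚ̄` then `g₂(M), g₃(M) ∈ ℚ̄` (analytic form of "the quotient of an
elliptic curve over `ℚ̄` by a finite subgroup is defined over `ℚ̄`"). Proof by `Aut(ℂ)`-rigidity
as in the module docstring: every conjugate `σ(gᵢ(M)) = gᵢ(M^σ)` lies in the finite set of
invariants of the lattices `Λ' + ℤf₁ + ℤf₂` (`lattice_eq_sup_span`) over the finitely many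
lattices `Λ'` with invariants conjugate to `g₂(Λ), g₃(Λ)`, and a complex number with finite
`Aut(ℂ)`-orbit is algebraic (`Complex.isIntegral_of_forall_ringEquiv_mem`, Cox §10.C). [folklore] -/
theorem isAlgebraic_g₂_g₃_of_le {L M : PeriodPair} (h₂ : IsAlgebraic ℚ L.g₂)
    (h₃ : IsAlgebraic ℚ L.g₃) (hLM : L.lattice ≤ M.lattice) :
    IsAlgebraic ℚ M.g₂ ∧ IsAlgebraic ℚ M.g₃ := by
  classical
  obtain ⟨N, hN, hNM⟩ := exists_nat_mul_mem_of_le hLM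
  have hNc : (N : ℂ) ≠ 0 := by exact_mod_cast hN
  have hNinv : (N : ℂ)⁻¹ ≠ 0 := inv_ne_zero hNc
  have hMle : M.lattice ≤ (L.mulLeft (N : ℂ)⁻¹ hNinv).lattice := fun x hx =>
    PeriodPair.mem_mulLeft_lattice.2 (by rw [inv_inv]; exact hNM x hx)
  have hi₂ : IsIntegral ℚ L.g₂ := isAlgebraic_iff_isIntegral.mp h₂
  have hi₃ : IsIntegral ℚ L.g₃ := isAlgebraic_iff_isIntegral.mp h₃
  -- conjugates of an algebraic number are roots of its minimal polynomial
  have hroot : ∀ {x : ℂ}, IsIntegral ℚ x → ∀ σ : ℂ ≃+* ℂ, σ x ∈ (minpoly ℚ x).rootSet ℂ := by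
    intro x hx σ
    refine Polynomial.mem_rootSet.2 ⟨minpoly.ne_zero hx, ?_⟩
    have key := Polynomial.aeval_algHom_apply σ.toRingHom.toRatAlgHom x (minpoly ℚ x)
    simp only [RingHom.toRatAlgHom_apply, RingEquiv.toRingHom_eq_coe, RingHom.coe_coe] at key
    rw [key, minpoly.aeval, map_zero]
  -- the candidate values: invariants of lattices `M₂` with `M₁ ⊆ M₂`, `N·M₂ ⊆ M₁`, `gᵢ(M₁) = A, B`
  set T : ℂ → ℂ → Set ℂ := fun A B => {g | ∃ M₁ M₂ : PeriodPair, M₁.g₂ = A ∧ M₁.g₃ = B ∧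
      M₁.lattice ≤ M₂.lattice ∧ (∀ x ∈ M₂.lattice, (N : ℂ) * x ∈ M₁.lattice) ∧
      (g = M₂.g₂ ∨ g = M₂.g₃)} with hT_def
  have hfib : ∀ Λ : Submodule ℤ ℂ,
      {g : ℂ | ∃ M₂ : PeriodPair, M₂.lattice = Λ ∧ (g = M₂.g₂ ∨ g = M₂.g₃)}.Finite := by
    intro Λ; by_cases hM : ∃ M' : PeriodPair, M'.lattice = Λ
    · obtain ⟨M', hM'⟩ := hM
      refine (Set.toFinite {M'.g₂, M'.g₃}).subset ?_
      rintro g ⟨M₂, hM₂, hg⟩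
      have hlat : M₂.lattice = M'.lattice := hM₂.trans hM'.symm
      rcases hg with rfl | rfl
      · exact Or.inl (PeriodPair.g₂_eq_of_lattice_eq hlat)
      · exact Or.inr (PeriodPair.g₃_eq_of_lattice_eq hlat)
    · refine Set.finite_empty.subset ?_
      rintro g ⟨M₂, hM₂, -⟩
      exact (hM ⟨M₂, hM₂⟩).elim
  have hTfin : ∀ A B, (T A B).Finite := by
    intro A B; by_cases hex : ∃ M₀ : PeriodPair, M₀.g₂ = A ∧ M₀.g₃ = B
    · obtain ⟨M₀, hA, hB⟩ := hex
      refine ((((Finset.range N ×ˢ Finset.range N).image fun pq : ℕ × ℕ =>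
          ((pq.1 : ℂ) * M₀.ω₁ + (pq.2 : ℂ) * M₀.ω₂) / N) ×ˢ
        ((Finset.range N ×ˢ Finset.range N).image fun pq : ℕ × ℕ =>
          ((pq.1 : ℂ) * M₀.ω₁ + (pq.2 : ℂ) * M₀.ω₂) / N)).finite_toSet.biUnion
          fun f _ => hfib (M₀.lattice ⊔ Submodule.span ℤ {f.1, f.2})).subset ?_
      rintro g ⟨M₁, M₂, h₁, h₂', hle, hNle, hg⟩
      have hM₁ : M₁.lattice = M₀.lattice :=
        PeriodPair.uniformization_unique_holds _ _ (h₁.trans hA.symm) (h₂'.trans hB.symm)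
      rw [hM₁] at hle hNle
      obtain ⟨f, hf, hΛ⟩ := lattice_eq_sup_span hN hle hNle
      exact Set.mem_biUnion (Finset.mem_coe.2 hf) ⟨M₂, hΛ, hg⟩
    · refine Set.finite_empty.subset ?_
      rintro g ⟨M₁, M₂, h₁, h₂', -⟩
      exact (hex ⟨M₁, h₁, h₂'⟩).elim
  set S : Set ℂ := ⋃ A ∈ (minpoly ℚ L.g₂).rootSet ℂ, ⋃ B ∈ (minpoly ℚ L.g₃).rootSet ℂ, T A B
    with hS_def
  have hSfin : S.Finite := (Polynomial.rootSet_finite _ _).biUnion fun A _ =>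
    (Polynomial.rootSet_finite _ _).biUnion fun B _ => hTfin A B
  -- every conjugate of `g₂(M)`, `g₃(M)` lies in `S`
  have hmem : ∀ σ : ℂ ≃+* ℂ, σ M.g₂ ∈ S ∧ σ M.g₃ ∈ S := by
    intro σ
    have hΔL : (σ L.g₂) ^ 3 - 27 * (σ L.g₃) ^ 2 ≠ 0 := by
      intro h0; apply L.discr_ne_zero; apply σ.injective
      simpa [map_sub, map_mul, map_pow, map_ofNat] using h0
    have hΔM : (σ M.g₂) ^ 3 - 27 * (σ M.g₃) ^ 2 ≠ 0 := by
      intro h0; apply M.discr_ne_zero; apply σ.injective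
      simpa [map_sub, map_mul, map_pow, map_ofNat] using h0
    obtain ⟨Lσ, hL₂, hL₃⟩ := PeriodPair.uniformization_holds _ _ hΔL
    obtain ⟨Mσ, hM₂, hM₃⟩ := PeriodPair.uniformization_holds _ _ hΔM
    have hle : Lσ.lattice ≤ Mσ.lattice := PeriodPair.lattice_le_of_le_map σ hLM hL₂ hL₃ hM₂ hM₃
    have hle' : Mσ.lattice ≤ (Lσ.mulLeft (N : ℂ)⁻¹ hNinv).lattice := by
      refine PeriodPair.lattice_le_of_le_map σ hMle hM₂ hM₃ ?_ ?_
      · rw [PeriodPair.g₂_mulLeft, PeriodPair.g₂_mulLeft, map_mul, hL₂]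
        congr 1; simp [map_pow, map_natCast]
      · rw [PeriodPair.g₃_mulLeft, PeriodPair.g₃_mulLeft, map_mul, hL₃]
        congr 1; simp [map_pow, map_natCast]
    have hN' : ∀ x ∈ Mσ.lattice, (N : ℂ) * x ∈ Lσ.lattice := fun x hx => by
      simpa only [inv_inv] using PeriodPair.mem_mulLeft_lattice.1 (hle' hx)
    have hin : ∀ g, (g = Mσ.g₂ ∨ g = Mσ.g₃) → g ∈ S := fun g hg => Set.mem_iUnion₂.2
      ⟨σ L.g₂, hroot hi₂ σ, Set.mem_iUnion₂.2 ⟨σ L.g₃, hroot hi₃ σ, Lσ, Mσ, hL₂, hL₃, hle, hN', hg⟩⟩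
    exact ⟨hin _ (Or.inl hM₂.symm), hin _ (Or.inr hM₃.symm)⟩
  exact ⟨(Complex.isIntegral_of_forall_ringEquiv_mem hSfin fun σ => (hmem σ).1).isAlgebraic,
    (Complex.isIntegral_of_forall_ringEquiv_mem hSfin fun σ => (hmem σ).2).isAlgebraic⟩

/-- **The multiplier of an analytic isogeny between lattices with algebraic invariants is
algebraic**: if `g₂, g₃` of `Λ` and of `Λ'` are algebraic, `α ≠ 0` and `αΛ ⊆ Λ'`, then `α ∈ ℚ̄` —
the over-lattice `α⁻¹Λ' ⊇ Λ` has algebraic invariants `α⁴g₂(Λ')`, `α⁶g₃(Λ')`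
(`isAlgebraic_g₂_g₃_of_le`, `PeriodPair.g₂_mulLeft`), not both zero (`PeriodPair.discr_ne_zero`),
so `α⁴` or `α⁶` is algebraic. [folklore] -/
theorem isAlgebraic_of_mul_mem_lattice {L L' : PeriodPair} (h₂ : IsAlgebraic ℚ L.g₂)
    (h₃ : IsAlgebraic ℚ L.g₃) (h₂' : IsAlgebraic ℚ L'.g₂) (h₃' : IsAlgebraic ℚ L'.g₃) {α : ℂ}
    (hα : α ≠ 0) (hαL : ∀ l ∈ L.lattice, α * l ∈ L'.lattice) : IsAlgebraic ℚ α := by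
  have hαi : α⁻¹ ≠ 0 := inv_ne_zero hα
  have hLM : L.lattice ≤ (L'.mulLeft α⁻¹ hαi).lattice := fun l hl =>
    PeriodPair.mem_mulLeft_lattice.2 (by rw [inv_inv]; exact hαL l hl)
  obtain ⟨hM₂, hM₃⟩ := isAlgebraic_g₂_g₃_of_le h₂ h₃ hLM
  rw [PeriodPair.g₂_mulLeft, inv_pow, inv_inv] at hM₂
  rw [PeriodPair.g₃_mulLeft, inv_pow, inv_inv] at hM₃
  by_cases hg₂ : L'.g₂ = 0
  · have hg₃ : L'.g₃ ≠ 0 := by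
      intro hg₃; apply L'.discr_ne_zero; simp [hg₂, hg₃]
    have h6 : IsAlgebraic ℚ (α ^ 6) := by
      have := hM₃.mul h₃'.inv
      rwa [mul_assoc, mul_inv_cancel₀ hg₃, mul_one] at this
    exact IsAlgebraic.of_pow (by norm_num) h6
  · have h4 : IsAlgebraic ℚ (α ^ 4) := by
      have := hM₂.mul h₂'.inv
      rwa [mul_assoc, mul_inv_cancel₀ hg₂, mul_one] at this
    exact IsAlgebraic.of_pow (by norm_num) h4

/-! ## §2 The stub, closed modulo `HuberWustholzManyCurvePeriods` -/

/-- **T — Huber–Wüstholz splitting** (lattice form of Wüstholz's solution of Baker's period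
problem; Baker–Wüstholz 2007, §6.2 Thm. 6.4; Huber–Wüstholz 2022, Thm. 15.3 (1), (3) with §15.2.2
and p. 193: "no `ℚ̄`-linear relations between non-trivial periods of different isotypical
components"), CLOSED MODULO the tree's named fact
`Literature.NumberTheory.Transcendental.HuberWustholzManyCurvePeriods` (pairwise non-isogenous
`k`-curve instance of Thm. 15.3; unproved in the tree — the analytic subgroup theorem), stated as
`Fact → T`: for lattices `Λ₁, …, Λ_k` with algebraic invariants and algebraic `βⱼ, β'ⱼ`, a
vanishing combination `∑ⱼ (βⱼ ω₁⁽ʲ⁾ + β'ⱼ ω₂⁽ʲ⁾) = 0` splits along the isogeny classes: for every `i` and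
`S = {j | Λᵢ ~ Λⱼ}`, `∑_{j ∈ S} (βⱼ ω₁⁽ʲ⁾ + β'ⱼ ω₂⁽ʲ⁾) = 0`. Proof: module docstring, §2 (algebraic
isogeny multipliers `isAlgebraic_of_mul_mem_lattice`, regrouping over least-index class
representatives by `Finset.sum_fiberwise_of_maps_to`, the fact with zero coefficients on
`1, 2πi, η₁, η₂`). The conclusion is VERBATIM the registered signature of
`stub_huberWustholzSplitting` (from the stronger fact `HuberWustholzIsotypicSplitting` it is the
tree's `HuberWustholzIsotypicSplitting.omega_subsum`).
[cite: HuberWustholz2022, Thm. 15.3 (1),(3) p. 145 with §15.2.2 Prop. 15.9 and p. 193] -/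
theorem stub_huberWustholzSplitting_of : Literature.NumberTheory.Transcendental.HuberWustholzManyCurvePeriods → ∀ (k : ℕ) (L : Fin k → PeriodPair) (β β' : Fin k → ℂ), (∀ i, IsAlgebraic ℚ (L i).g₂ ∧ IsAlgebraic ℚ (L i).g₃) → (∀ i, IsAlgebraic ℚ (β i) ∧ IsAlgebraic ℚ (β' i)) → ∑ i, (β i * (L i).ω₁ + β' i * (L i).ω₂) = 0 → ∀ (i : Fin k) (S : Finset (Fin k)), (∀ j, j ∈ S ↔ (L i).IsIsogenousTo (L j)) → ∑ j ∈ S, (β j * (L j).ω₁ + β' j * (L j).ω₂) = 0 := by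
  intro hHW k L β β' hL hβ hsum i S hS
  classical
  -- (a) isogeny classes and their least-index representatives
  set cls : Fin k → Finset (Fin k) :=
    fun j => Finset.univ.filter fun j' => (L j).IsIsogenousTo (L j') with hcls_def
  have hcls : ∀ j j', j' ∈ cls j ↔ (L j).IsIsogenousTo (L j') := fun j j' => by simp [hcls_def]
  have hself : ∀ j, j ∈ cls j := fun j => (hcls j j).2 (PeriodPair.isIsogenousTo_refl _)
  have hcls_eq : ∀ j j', (L j).IsIsogenousTo (L j') → cls j = cls j' := fun j j' h => by
    ext x; rw [hcls, hcls]; exact ⟨fun hx => h.symm.trans hx, fun hx => h.trans hx⟩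
  set rep : Fin k → Fin k := fun j => (cls j).min' ⟨j, hself j⟩ with hrep_def
  have hrep_mem : ∀ j, rep j ∈ cls j := fun j => Finset.min'_mem _ _
  have hrep_iso : ∀ j, (L j).IsIsogenousTo (L (rep j)) := fun j => (hcls j _).1 (hrep_mem j)
  have hrep_eq : ∀ j j', (L j).IsIsogenousTo (L j') → rep j = rep j' := fun j j' h =>
    le_antisymm (Finset.min'_le _ _ (by rw [hcls_eq j j' h]; exact hrep_mem j'))
      (Finset.min'_le _ _ (by rw [← hcls_eq j j' h]; exact hrep_mem j))
  have hiso_of_rep_eq : ∀ j j', rep j = rep j' → (L j).IsIsogenousTo (L j') :=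
    fun j j' h => (hrep_iso j).trans (h ▸ (hrep_iso j').symm)
  have hrep_rep : ∀ j, rep (rep j) = rep j := fun j => hrep_eq _ _ (hrep_iso j).symm
  -- (b) multipliers (algebraic, §1) and integer coordinates on the representative's periods
  choose α hα0 hαL using hrep_iso
  have hαalg : ∀ j, IsAlgebraic ℚ (α j) := fun j =>
    isAlgebraic_of_mul_mem_lattice (hL j).1 (hL j).2 (hL (rep j)).1 (hL (rep j)).2 (hα0 j) (hαL j)
  choose a b hab using fun j => PeriodPair.mem_lattice.1 (hαL j _ (L j).ω₁_mem_lattice)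
  choose c d hcd using fun j => PeriodPair.mem_lattice.1 (hαL j _ (L j).ω₂_mem_lattice)
  set u : Fin k → ℂ := fun j => (β j * a j + β' j * c j) * (α j)⁻¹ with hu_def
  set v : Fin k → ℂ := fun j => (β j * b j + β' j * d j) * (α j)⁻¹ with hv_def
  have hualg : ∀ j, IsAlgebraic ℚ (u j) := fun j =>
    (((hβ j).1.mul (isAlgebraic_int _)).add ((hβ j).2.mul (isAlgebraic_int _))).mul (hαalg j).inv
  have hvalg : ∀ j, IsAlgebraic ℚ (v j) := fun j =>
    (((hβ j).1.mul (isAlgebraic_int _)).add ((hβ j).2.mul (isAlgebraic_int _))).mul (hαalg j).inv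
  have hkey : ∀ j, β j * (L j).ω₁ + β' j * (L j).ω₂ =
      u j * (L (rep j)).ω₁ + v j * (L (rep j)).ω₂ := by
    intro j
    have h0 := hα0 j
    have e1 : u j * (L (rep j)).ω₁ + v j * (L (rep j)).ω₂
        = (α j)⁻¹ * (β j * ((a j : ℂ) * (L (rep j)).ω₁ + (b j : ℂ) * (L (rep j)).ω₂)
          + β' j * ((c j : ℂ) * (L (rep j)).ω₁ + (d j : ℂ) * (L (rep j)).ω₂)) := by
      simp only [hu_def, hv_def]; ring
    rw [e1, hab j, hcd j, show β j * (α j * (L j).ω₁) + β' j * (α j * (L j).ω₂)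
        = α j * (β j * (L j).ω₁ + β' j * (L j).ω₂) by ring, ← mul_assoc, inv_mul_cancel₀ h0,
      one_mul]
  -- (c) the class blocks, indexed by representatives
  set A' : Fin k → ℂ := fun r => ∑ j ∈ Finset.univ.filter (fun j => rep j = r), u j with hA'_def
  set B' : Fin k → ℂ := fun r => ∑ j ∈ Finset.univ.filter (fun j => rep j = r), v j with hB'_def
  have hA'alg : ∀ r, IsAlgebraic ℚ (A' r) := fun r =>
    (Subalgebra.algebraicClosure ℚ ℂ).sum_mem fun j _ =>
      (hualg j : u j ∈ Subalgebra.algebraicClosure ℚ ℂ)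
  have hB'alg : ∀ r, IsAlgebraic ℚ (B' r) := fun r =>
    (Subalgebra.algebraicClosure ℚ ℂ).sum_mem fun j _ =>
      (hvalg j : v j ∈ Subalgebra.algebraicClosure ℚ ℂ)
  have hblk : ∀ r, ∑ j ∈ Finset.univ.filter (fun j => rep j = r),
      (β j * (L j).ω₁ + β' j * (L j).ω₂) = A' r * (L r).ω₁ + B' r * (L r).ω₂ := by
    intro r
    rw [hA'_def, hB'_def, Finset.sum_mul, Finset.sum_mul, ← Finset.sum_add_distrib]
    refine Finset.sum_congr rfl fun j hj => ?_
    have hr : rep j = r := (Finset.mem_filter.1 hj).2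
    rw [hkey j, hr]
  -- (d) the pairwise non-isogenous family of representatives, indexed by `Fin m`
  set Rset : Finset (Fin k) := Finset.univ.image rep with hRset_def
  have hmemR : ∀ j, rep j ∈ Rset := fun j => Finset.mem_image_of_mem _ (Finset.mem_univ j)
  set m : ℕ := Rset.card with hm_def
  set e : Fin m ≃ {x // x ∈ Rset} := Rset.equivFin.symm with he_def
  set L' : Fin m → PeriodPair := fun t => L (e t).1 with hL'_def
  have hL' : ∀ t, IsAlgebraic ℚ (L' t).g₂ ∧ IsAlgebraic ℚ (L' t).g₃ := fun t => hL _
  have hrepR : ∀ x : {x // x ∈ Rset}, rep x.1 = x.1 := by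
    rintro ⟨x, hx⟩
    obtain ⟨j, -, rfl⟩ := Finset.mem_image.1 hx
    exact hrep_rep j
  have hiso' : ∀ t t', t ≠ t' → ¬ (L' t).IsIsogenousTo (L' t') := by
    intro t t' hne hiso
    refine hne (e.injective (Subtype.ext ?_))
    have h1 := hrep_eq _ _ hiso
    rwa [hrepR, hrepR] at h1
  -- (e) the regrouped relation over the representatives, and the fact
  have hsum' : (0 : ℂ) + 0 * (2 * Real.pi * I) +
      ∑ t, (A' (e t).1 * (L' t).ω₁ + B' (e t).1 * (L' t).ω₂ + 0 * (L' t).η₁ + 0 * (L' t).η₂)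
        = 0 := by
    simp only [zero_mul, add_zero, zero_add]
    calc ∑ t, (A' (e t).1 * (L' t).ω₁ + B' (e t).1 * (L' t).ω₂)
        = ∑ x : {x // x ∈ Rset}, (A' x.1 * (L x.1).ω₁ + B' x.1 * (L x.1).ω₂) :=
          e.sum_comp (fun x : {x // x ∈ Rset} => A' x.1 * (L x.1).ω₁ + B' x.1 * (L x.1).ω₂)
      _ = ∑ r ∈ Rset, (A' r * (L r).ω₁ + B' r * (L r).ω₂) :=
          Finset.sum_coe_sort Rset (fun r => A' r * (L r).ω₁ + B' r * (L r).ω₂)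
      _ = ∑ r ∈ Rset, ∑ j ∈ Finset.univ.filter (fun j => rep j = r),
            (β j * (L j).ω₁ + β' j * (L j).ω₂) := Finset.sum_congr rfl fun r _ => (hblk r).symm
      _ = ∑ j, (β j * (L j).ω₁ + β' j * (L j).ω₂) :=
          Finset.sum_fiberwise_of_maps_to (fun j _ => hmemR j) _
      _ = 0 := hsum
  obtain ⟨-, -, hblock, -⟩ := hHW m L' hL' hiso' 0 0 (fun t => A' (e t).1) (fun t => B' (e t).1)
    (fun _ => 0) (fun _ => 0) isAlgebraic_zero isAlgebraic_zero
    (fun t => ⟨hA'alg _, hB'alg _, isAlgebraic_zero, isAlgebraic_zero⟩) hsum'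
  -- (f) the class of `i` is the fibre of its representative
  have hSeq : S = Finset.univ.filter (fun j => rep j = rep i) := by
    ext j
    rw [hS j, Finset.mem_filter]
    exact ⟨fun h => ⟨Finset.mem_univ _, (hrep_eq _ _ h).symm⟩,
      fun h => hiso_of_rep_eq _ _ h.2.symm⟩
  have het₀ : (e (e.symm ⟨rep i, hmemR i⟩)).1 = rep i := by rw [Equiv.apply_symm_apply]
  have h0 := hblock (e.symm ⟨rep i, hmemR i⟩)
  simp only [zero_mul, add_zero, hL'_def, het₀] at h0
  rw [hSeq, hblk, h0]

end Summit.KontsevichZagierPeriods.IsogenyCertificates.XMapKernelStubs.HuberWustholzSplitting
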